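import Mathlib
import Summits.Ventures.Crystal3D.Theorems.StickyWulffConstantTextureLiminfTentHatAffine
import HarnessLib

/-!
# The tent certificate for fcc grains — the chambers (cells) of the coned tet–oct arrangement (eng g8)

Route `StickyWulffConstant` (`Summits/Ventures/Crystal3D`, cell `crystal3d-full`), support toward the crux
`TextureLiminf` (stmt-Ventures-19483), FREE half (tent certificate, TexShadow v6.1).  For the chambers
`cellOf k m` of `…TentHatDefs.lean` (fourteen strict inequalities `k_i < y_i < k_i + 1`,
`2m_j < ⟪a_j, y⟫ < 2m_j + 2` in `y = √2 • x`): the membership lemma, `cellOf ⊆ closedChamber ⊇ closure`,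
boundedness, closedness of `closedChamber`, and DISJOINTNESS of chambers with distinct labels (they are
separated by a plane of the arrangement).  Then the tent `f_X` is affine on every closed chamber
(`exists_affine_tent`, from `exists_affine_hatL/hatH` by the lattice/hole shifts
`exists_affine_hatL_shift`, `exists_affine_hatH_shift`), continuous (`continuous_tent`), nonnegative, and
takes the values `1_X` at the sites and `twoAlpha/2` at the octahedron centres (`tent_site`,
`tent_hole`).
WHAT THIS IS NOT: the classification of nonempty chambers / the certificate; F-C1 not moved.
-/

noncomputable section

namespace Summit.Ventures.Crystal3D.TentCertificate

open Finset Summit.Ventures.Crystal3D MeasureTheory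
open Literature.Geometry.DiscreteGeometry (intVec intVec_apply)
open scoped RealInnerProductSpace

/-! ## Membership, closure, boundedness, disjointness -/

/-- `⟪√2 • e_i, x⟫ = √2 · x_i`. -/
theorem inner_sqrt2_single (i : Fin 3) (x : EuclideanSpace ℝ (Fin 3)) :
    ⟪Real.sqrt 2 • EuclideanSpace.single i (1 : ℝ), x⟫ = Real.sqrt 2 * x i := by
  rw [real_inner_smul_left, EuclideanSpace.inner_single_left]; simp

/-- `⟪√2 • intVec a, x⟫ = ⟪intVec a, √2 • x⟫`. -/
theorem inner_sqrt2_intVec (a : Site) (x : EuclideanSpace ℝ (Fin 3)) :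
    ⟪Real.sqrt 2 • intVec a, x⟫ = ⟪intVec a, Real.sqrt 2 • x⟫ := by
  rw [real_inner_smul_left, real_inner_smul_right]

/-- **Membership in a chamber.** -/
theorem mem_cellOf_iff (k : Fin 3 → ℤ) (m : Fin 4 → ℤ) (x : EuclideanSpace ℝ (Fin 3)) :
    x ∈ cellOf k m ↔
      (∀ i : Fin 3, (k i : ℝ) < Real.sqrt 2 * x i ∧ Real.sqrt 2 * x i < k i + 1) ∧
      (∀ j : Fin 4, 2 * (m j : ℝ) < ⟪intVec (normal4 j), Real.sqrt 2 • x⟫ ∧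
        ⟪intVec (normal4 j), Real.sqrt 2 • x⟫ < 2 * m j + 2) := by
  rw [cellOf, Set.mem_iInter₂]
  constructor
  · intro h
    refine ⟨fun i => ⟨?_, ?_⟩, fun j => ⟨?_, ?_⟩⟩
    · have h1 := h (-(Real.sqrt 2 • EuclideanSpace.single i (1 : ℝ)), -(k i : ℝ))
        (Finset.mem_union_left _ (Finset.mem_union_left _ (Finset.mem_union_right _
          (Finset.mem_image_of_mem (fun i : Fin 3 =>
            (-(Real.sqrt 2 • EuclideanSpace.single i (1 : ℝ)), -(k i : ℝ))) (Finset.mem_univ i)))))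
      simp only [Set.mem_setOf_eq, inner_neg_left, inner_sqrt2_single] at h1
      linarith
    · have h1 := h (Real.sqrt 2 • EuclideanSpace.single i (1 : ℝ), (k i : ℝ) + 1)
        (Finset.mem_union_left _ (Finset.mem_union_left _ (Finset.mem_union_left _
          (Finset.mem_image_of_mem (fun i : Fin 3 =>
            (Real.sqrt 2 • EuclideanSpace.single i (1 : ℝ), (k i : ℝ) + 1)) (Finset.mem_univ i)))))
      simp only [Set.mem_setOf_eq, inner_sqrt2_single] at h1
      exact h1
    · have h1 := h (-(Real.sqrt 2 • intVec (normal4 j)), -(2 * (m j : ℝ)))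
        (Finset.mem_union_right _ (Finset.mem_image_of_mem (fun j : Fin 4 =>
            (-(Real.sqrt 2 • intVec (normal4 j)), -(2 * (m j : ℝ)))) (Finset.mem_univ j)))
      simp only [Set.mem_setOf_eq, inner_neg_left, inner_sqrt2_intVec] at h1
      linarith
    · have h1 := h (Real.sqrt 2 • intVec (normal4 j), 2 * (m j : ℝ) + 2)
        (Finset.mem_union_left _ (Finset.mem_union_right _ (Finset.mem_image_of_mem (fun j : Fin 4 =>
            (Real.sqrt 2 • intVec (normal4 j), 2 * (m j : ℝ) + 2)) (Finset.mem_univ j))))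
      simp only [Set.mem_setOf_eq, inner_sqrt2_intVec] at h1
      exact h1
  · rintro ⟨hk, hm⟩ q hq
    simp only [chamberH, Finset.mem_union, Finset.mem_image, Finset.mem_univ, true_and] at hq
    simp only [Set.mem_setOf_eq]
    rcases hq with ((⟨i, rfl⟩ | ⟨i, rfl⟩) | ⟨j, rfl⟩) | ⟨j, rfl⟩
    · rw [inner_sqrt2_single]; exact (hk i).2
    · rw [inner_neg_left, inner_sqrt2_single]; linarith [(hk i).1]
    · rw [inner_sqrt2_intVec]; exact (hm j).2
    · rw [inner_neg_left, inner_sqrt2_intVec]; linarith [(hm j).1]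

/-- A chamber lies in its closed chamber. -/
theorem cellOf_subset_closedChamber (k : Fin 3 → ℤ) (m : Fin 4 → ℤ) : cellOf k m ⊆ closedChamber k m := by
  intro x hx
  obtain ⟨hk, hm⟩ := (mem_cellOf_iff k m x).1 hx
  exact ⟨fun i => ⟨(hk i).1.le, (hk i).2.le⟩, fun j => ⟨(hm j).1.le, (hm j).2.le⟩⟩

/-- The closed chamber is closed. -/
theorem isClosed_closedChamber (k : Fin 3 → ℤ) (m : Fin 4 → ℤ) : IsClosed (closedChamber k m) := by
  have h1 : ∀ i : Fin 3, Continuous fun x : EuclideanSpace ℝ (Fin 3) => Real.sqrt 2 * x i :=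
    fun i => continuous_const.mul (EuclideanSpace.proj i).continuous
  have h2 : ∀ j : Fin 4, Continuous fun x : EuclideanSpace ℝ (Fin 3) =>
      ⟪intVec (normal4 j), Real.sqrt 2 • x⟫ :=
    fun j => continuous_const.inner (continuous_id.const_smul (Real.sqrt 2))
  simp only [closedChamber, Set.setOf_and, Set.setOf_forall]
  refine (isClosed_iInter fun i => (isClosed_le continuous_const (h1 i)).inter
    (isClosed_le (h1 i) continuous_const)).inter (isClosed_iInter fun j =>
    (isClosed_le continuous_const (h2 j)).inter (isClosed_le (h2 j) continuous_const))

/-- The closure of a chamber lies in its closed chamber. -/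
theorem closure_cellOf_subset_closedChamber (k : Fin 3 → ℤ) (m : Fin 4 → ℤ) :
    closure (cellOf k m) ⊆ closedChamber k m :=
  closure_minimal (cellOf_subset_closedChamber k m) (isClosed_closedChamber k m)

/-- Coordinates are bounded on a closed chamber. -/
theorem abs_apply_le_of_mem_closedChamber {k : Fin 3 → ℤ} {m : Fin 4 → ℤ} {x : EuclideanSpace ℝ (Fin 3)}
    (hx : x ∈ closedChamber k m) (i : Fin 3) : |x i| ≤ |(k i : ℝ)| + 1 := by
  have hs : (1 : ℝ) ≤ Real.sqrt 2 := by
    rw [show (1 : ℝ) = Real.sqrt 1 by simp]; exact Real.sqrt_le_sqrt (by norm_num)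
  have h := hx.1 i
  have hxi : |x i| ≤ |Real.sqrt 2 * x i| := by
    rw [abs_mul, abs_of_pos (by positivity : (0 : ℝ) < Real.sqrt 2)]
    exact le_mul_of_one_le_left (abs_nonneg _) hs
  refine hxi.trans (abs_le.2 ⟨?_, ?_⟩) <;> cases abs_cases (k i : ℝ) <;> linarith [h.1, h.2]

/-- A closed chamber is bounded. -/
theorem isBounded_closedChamber (k : Fin 3 → ℤ) (m : Fin 4 → ℤ) :
    Bornology.IsBounded (closedChamber k m) := by
  rw [Metric.isBounded_iff_subset_closedBall (0 : EuclideanSpace ℝ (Fin 3))]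
  refine ⟨|(k 0 : ℝ)| + |(k 1 : ℝ)| + |(k 2 : ℝ)| + 3, fun x hx => ?_⟩
  rw [Metric.mem_closedBall, dist_zero_right, EuclideanSpace.norm_eq]
  have h0 := abs_apply_le_of_mem_closedChamber hx 0
  have h1 := abs_apply_le_of_mem_closedChamber hx 1
  have h2 := abs_apply_le_of_mem_closedChamber hx 2
  have hsum : ∑ i : Fin 3, ‖x i‖ ^ 2 ≤ (|(k 0 : ℝ)| + |(k 1 : ℝ)| + |(k 2 : ℝ)| + 3) ^ 2 := by
    rw [Fin.sum_univ_three]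
    simp only [Real.norm_eq_abs]
    nlinarith [abs_nonneg (x 0), abs_nonneg (x 1), abs_nonneg (x 2), abs_nonneg (k 0 : ℝ),
      abs_nonneg (k 1 : ℝ), abs_nonneg (k 2 : ℝ)]
  calc Real.sqrt (∑ i : Fin 3, ‖x i‖ ^ 2)
      ≤ Real.sqrt ((|(k 0 : ℝ)| + |(k 1 : ℝ)| + |(k 2 : ℝ)| + 3) ^ 2) := Real.sqrt_le_sqrt hsum
    _ = |(k 0 : ℝ)| + |(k 1 : ℝ)| + |(k 2 : ℝ)| + 3 := Real.sqrt_sq (by positivity)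

/-- A chamber is bounded. -/
theorem isBounded_cellOf (k : Fin 3 → ℤ) (m : Fin 4 → ℤ) : Bornology.IsBounded (cellOf k m) :=
  (isBounded_closedChamber k m).subset (cellOf_subset_closedChamber k m)

/-- **Chambers with distinct labels are disjoint** (a plane of the arrangement separates them). -/
theorem disjoint_cellOf {k k' : Fin 3 → ℤ} {m m' : Fin 4 → ℤ} (h : (k, m) ≠ (k', m')) :
    Disjoint (cellOf k m) (cellOf k' m') := by
  rw [Set.disjoint_left]
  intro x hx hx'
  obtain ⟨hk, hm⟩ := (mem_cellOf_iff k m x).1 hx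
  obtain ⟨hk', hm'⟩ := (mem_cellOf_iff k' m' x).1 hx'
  apply h
  have ek : k = k' := by
    funext i
    by_contra hne
    rcases lt_or_gt_of_ne hne with hlt | hlt
    · have : (k i : ℝ) + 1 ≤ k' i := by exact_mod_cast hlt
      linarith [(hk i).2, (hk' i).1]
    · have : (k' i : ℝ) + 1 ≤ k i := by exact_mod_cast hlt
      linarith [(hk' i).2, (hk i).1]
  have em : m = m' := by
    funext j
    by_contra hne
    rcases lt_or_gt_of_ne hne with hlt | hlt
    · have : (m j : ℝ) + 1 ≤ m' j := by exact_mod_cast hlt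
      linarith [(hm j).2, (hm' j).1]
    · have : (m' j : ℝ) + 1 ≤ m j := by exact_mod_cast hlt
      linarith [(hm' j).2, (hm j).1]
  rw [ek, em]

/-! ## The tent is affine on every closed chamber -/

/-- `⟪a_j, fccPoint w⟫ = 2 · (w₀+w₁+w₂, w₀, w₁, w₂)_j`: lattice points have EVEN `(111)` levels. -/
theorem inner_normal4_fccPoint (j : Fin 4) (w : Site) :
    ⟪intVec (normal4 j), intVec (fccPoint w)⟫ = 2 * ((![w 0 + w 1 + w 2, w 0, w 1, w 2] j : ℤ) : ℝ) := by
  rw [inner_intVec_left]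
  fin_cases j <;> simp [normal4, fccPoint, intVec_apply] <;> ring

/-- `⟪a_j, holeZ p⟫ = 2 · (p₀+p₁+p₂, p₀, p₁, p₂ − 1)_j + 1`: holes have ODD `(111)` levels. -/
theorem inner_normal4_holeZ (j : Fin 4) (p : Site) :
    ⟪intVec (normal4 j), intVec (holeZ p)⟫ =
      2 * ((![p 0 + p 1 + p 2, p 0, p 1, p 2 - 1] j : ℤ) : ℝ) + 1 := by
  rw [inner_intVec_left]
  fin_cases j <;> simp [normal4, holeZ, fccPoint, intVec_apply] <;> ring

/-- **Lattice hat functions are affine on closed chambers.** -/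
theorem exists_affine_hatL_shift (k : Fin 3 → ℤ) (m : Fin 4 → ℤ) (w : Site) :
    ∃ g : EuclideanSpace ℝ (Fin 3), ∃ b : ℝ, ∀ x ∈ closedChamber k m,
      hatL (Real.sqrt 2 • x - intVec (fccPoint w)) = ⟪g, x⟫ + b := by
  set c : Fin 4 → ℤ := ![w 0 + w 1 + w 2, w 0, w 1, w 2] with hc
  obtain ⟨g, b, hgb⟩ := exists_affine_hatL (fun i => k i - fccPoint w i) (fun j => m j - c j)
  refine ⟨Real.sqrt 2 • g, b - ⟪g, intVec (fccPoint w)⟫, fun x hx => ?_⟩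
  have h1 : ∀ i, ((k i - fccPoint w i : ℤ) : ℝ) ≤ (Real.sqrt 2 • x - intVec (fccPoint w)) i ∧
      (Real.sqrt 2 • x - intVec (fccPoint w)) i ≤ ((k i - fccPoint w i : ℤ) : ℝ) + 1 := by
    intro i
    have := hx.1 i
    simp only [PiLp.sub_apply, PiLp.smul_apply, smul_eq_mul, intVec_apply, Int.cast_sub]
    constructor <;> linarith [this.1, this.2]
  have h2 : ∀ j, 2 * ((m j - c j : ℤ) : ℝ) ≤ ⟪intVec (normal4 j), Real.sqrt 2 • x - intVec (fccPoint w)⟫ ∧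
      ⟪intVec (normal4 j), Real.sqrt 2 • x - intVec (fccPoint w)⟫ ≤ 2 * ((m j - c j : ℤ) : ℝ) + 2 := by
    intro j
    have := hx.2 j
    rw [inner_sub_right, inner_normal4_fccPoint, ← hc]
    push_cast
    constructor <;> linarith [this.1, this.2]
  rw [hgb _ h1 h2, inner_sub_right, real_inner_smul_right, real_inner_smul_left]
  ring

/-- **Hole hat functions are affine on closed chambers.** -/
theorem exists_affine_hatH_shift (k : Fin 3 → ℤ) (m : Fin 4 → ℤ) (p : Site) :
    ∃ g : EuclideanSpace ℝ (Fin 3), ∃ b : ℝ, ∀ x ∈ closedChamber k m,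
      hatH (Real.sqrt 2 • x - intVec (holeZ p)) = ⟪g, x⟫ + b := by
  set c : Fin 4 → ℤ := ![p 0 + p 1 + p 2, p 0, p 1, p 2 - 1] with hc
  obtain ⟨g, b, hgb⟩ := exists_affine_hatH (fun i => k i - holeZ p i) (fun j => m j - c j)
  refine ⟨Real.sqrt 2 • g, b - ⟪g, intVec (holeZ p)⟫, fun x hx => ?_⟩
  have h1 : ∀ i, ((k i - holeZ p i : ℤ) : ℝ) ≤ (Real.sqrt 2 • x - intVec (holeZ p)) i ∧
      (Real.sqrt 2 • x - intVec (holeZ p)) i ≤ ((k i - holeZ p i : ℤ) : ℝ) + 1 := by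
    intro i
    have := hx.1 i
    simp only [PiLp.sub_apply, PiLp.smul_apply, smul_eq_mul, intVec_apply, Int.cast_sub]
    constructor <;> linarith [this.1, this.2]
  have h2 : ∀ j, 2 * ((m j - c j : ℤ) : ℝ) - 1 ≤ ⟪intVec (normal4 j), Real.sqrt 2 • x - intVec (holeZ p)⟫ ∧
      ⟪intVec (normal4 j), Real.sqrt 2 • x - intVec (holeZ p)⟫ ≤ 2 * ((m j - c j : ℤ) : ℝ) + 1 := by
    intro j
    have := hx.2 j
    rw [inner_sub_right, inner_normal4_holeZ, ← hc]
    push_cast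
    constructor <;> linarith [this.1, this.2]
  rw [hgb _ h1 h2, inner_sub_right, real_inner_smul_right, real_inner_smul_left]
  ring

/-- A finite sum of functions affine on a set is affine on it. -/
theorem exists_affine_finset_sum {ι : Type*} (s : Finset ι) (F : ι → EuclideanSpace ℝ (Fin 3) → ℝ)
    (C : Set (EuclideanSpace ℝ (Fin 3)))
    (h : ∀ i ∈ s, ∃ g : EuclideanSpace ℝ (Fin 3), ∃ b : ℝ, ∀ x ∈ C, F i x = ⟪g, x⟫ + b) :
    ∃ g : EuclideanSpace ℝ (Fin 3), ∃ b : ℝ, ∀ x ∈ C, ∑ i ∈ s, F i x = ⟪g, x⟫ + b := by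
  classical
  induction s using Finset.induction_on with
  | empty => exact ⟨0, 0, fun x _ => by simp⟩
  | insert a s ha ih =>
    obtain ⟨g₁, b₁, h₁⟩ := h a (Finset.mem_insert_self a s)
    obtain ⟨g₂, b₂, h₂⟩ := ih (fun i hi => h i (Finset.mem_insert_of_mem hi))
    refine ⟨g₁ + g₂, b₁ + b₂, fun x hx => ?_⟩
    rw [Finset.sum_insert ha, h₁ x hx, h₂ x hx, inner_add_left]
    ring

/-- **The tent is affine on every closed chamber.** -/
theorem exists_affine_tent (X : Finset Site) (k : Fin 3 → ℤ) (m : Fin 4 → ℤ) :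
    ∃ g : EuclideanSpace ℝ (Fin 3), ∃ b : ℝ, ∀ x ∈ closedChamber k m, tent X x = ⟪g, x⟫ + b := by
  obtain ⟨g₁, b₁, h₁⟩ := exists_affine_finset_sum X
    (fun w x => hatL (Real.sqrt 2 • x - intVec (fccPoint w))) (closedChamber k m)
    (fun w _ => exists_affine_hatL_shift k m w)
  obtain ⟨g₂, b₂, h₂⟩ := exists_affine_finset_sum (idx X)
    (fun p x => ((twoAlpha (patO X p) : ℝ) / 2) * hatH (Real.sqrt 2 • x - intVec (holeZ p)))
    (closedChamber k m) (fun p _ => by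
      obtain ⟨g, b, hgb⟩ := exists_affine_hatH_shift k m p
      refine ⟨((twoAlpha (patO X p) : ℝ) / 2) • g, ((twoAlpha (patO X p) : ℝ) / 2) * b, fun x hx => ?_⟩
      rw [hgb x hx, real_inner_smul_left]; ring)
  refine ⟨g₁ + g₂, b₁ + b₂, fun x hx => ?_⟩
  rw [tent, h₁ x hx, h₂ x hx, inner_add_left]
  ring

/-! ## Continuity, sign and vertex values of the tent -/

/-- `cubo` is continuous. -/
theorem continuous_cubo : Continuous cubo := by
  unfold cubo
  fun_prop

/-- `hatL` is continuous. -/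
theorem continuous_hatL : Continuous hatL := by
  unfold hatL
  exact continuous_const.max (continuous_const.sub continuous_cubo)

/-- `hatH` is continuous. -/
theorem continuous_hatH : Continuous hatH := by
  unfold hatH
  fun_prop

/-- **The tent is continuous.** -/
theorem continuous_tent (X : Finset Site) : Continuous (tent X) := by
  unfold tent
  refine Continuous.add (continuous_finsetSum _ fun w _ => ?_) (continuous_finsetSum _ fun p _ => ?_)
  · exact continuous_hatL.comp (by fun_prop)
  · exact continuous_const.mul (continuous_hatH.comp (by fun_prop))

/-- `twoAlpha ≥ 0`. -/
theorem twoAlpha_nonneg (b : Fin 6 → Bool) : 0 ≤ twoAlpha b := by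
  unfold twoAlpha; split_ifs <;> norm_num

/-- The tent is nonnegative. -/
theorem tent_nonneg (X : Finset Site) (x : EuclideanSpace ℝ (Fin 3)) : 0 ≤ tent X x := by
  unfold tent
  refine add_nonneg (Finset.sum_nonneg fun w _ => hatL_nonneg _)
    (Finset.sum_nonneg fun p _ => mul_nonneg ?_ (hatH_nonneg _))
  have := twoAlpha_nonneg (patO X p)
  positivity

/-- **Vertex values at the sites**: `f_X(site v) = 1_X(v)` (`site v = (√2)⁻¹ • fccPoint v`). -/
theorem tent_site (X : Finset Site) (v : Site) :
    tent X ((Real.sqrt 2)⁻¹ • intVec (fccPoint v)) = if v ∈ X then 1 else 0 := by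
  classical
  have hs : Real.sqrt 2 • ((Real.sqrt 2)⁻¹ • intVec (fccPoint v)) = intVec (fccPoint v) := by
    rw [smul_smul, mul_inv_cancel₀ (by positivity), one_smul]
  unfold tent
  simp only [hs, hatL_intVec_fccPoint_sub, hatH_intVec_fccPoint_sub, mul_zero, Finset.sum_const_zero,
    add_zero]
  rw [Finset.sum_ite_eq X v (fun _ => (1 : ℝ))]

/-- **Vertex values at the octahedron centres**: `f_X(hole p) = twoAlpha/2` for `p ∈ idx X`, and `0`
for octahedra without occupied vertices. -/
theorem tent_hole (X : Finset Site) (p : Site) :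
    tent X ((Real.sqrt 2)⁻¹ • intVec (holeZ p)) = if p ∈ idx X then (twoAlpha (patO X p) : ℝ) / 2 else 0 := by
  classical
  have hs : Real.sqrt 2 • ((Real.sqrt 2)⁻¹ • intVec (holeZ p)) = intVec (holeZ p) := by
    rw [smul_smul, mul_inv_cancel₀ (by positivity), one_smul]
  unfold tent
  simp only [hs, hatL_intVec_holeZ_sub, Finset.sum_const_zero, zero_add, hatH_intVec_holeZ_sub]
  simp_rw [mul_ite, mul_one, mul_zero]
  rw [Finset.sum_ite_eq (idx X) p]

end Summit.Ventures.Crystal3D.TentCertificate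

end
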